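import Summits.QuantumFields.BalabanUV.Beta.CompositeOneShotJets
import Summits.QuantumFields.BalabanUV.Beta.FP.StepRecursionFeed

/-!
# `BalabanUV.Beta.CompositeOneShotJetData` — row D1 ∕ (C1), file F6d part 2: **THE COMPOSITE ONE-SHOT JET DATA OF RECORD `JcComp`, DIRECT AND PIECEWISE,
# AND (L2′) `hN` BY NAME** (SPEC S-an2-g52-1 §1 ∕ §4 under RULING R-D1-g52-1: (β1) + (D-b) + (A))

WHAT.  Blocking `Lc` (`[NeZero Lc]`, `Odd Lc` where the (III′) literal is read), dimension `d + 1 = 4`.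
* §1 [our object — bookkeeping] the two parameter records of the construction: `Roots Lc` = the corrector's root list `rc` (K-U3d's `Ψ̂_m = psiK rc Lc m`), the brick
  root `r` (the (0.4)-symmetrised bricks `symLinKerAt ∕ symVhKerAt ∕ symHessKerAt ∕ symVh2KerSymAt ∕ symMixKerAt (toSite r) Lc`) and the in-block big-root offsets
  `s m ∈ box 4 (Lc^m)` of the block-mean dressing at every depth, with their box memberships; **`Roots.ctr Lc`** = the (β1) tower's choice (R-D1-g49-1 ∕ R-D1-g52-1:
  CENTRED at every level — `rc k = r = ctrOff 4 Lc`, `s m = ctrOff 4 (Lc^m)`, cf. leaf-05's F6f `FP/TowerRootCentred`); `Pins` = the depth-indexed pins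
  `cM cE cVH cΛ cE₂ cB T` of the (III′)-shaped literal at blocking `Lc^m` (PIN P-F6-2: parameters here; the literal's values `((Lc^m)⁴, −(Lc^m)⁸∕2, (Lc^m)⁸)`, `T_m`,
  the composite unit `u_m` and the locks are fixed by the consumer at the junctions).
* §2 [our object — bookkeeping] `JNat R P m : JetData 3 (Lc^m)` := F6d-1b's raw composite jets `JN` at `(R, P, m)`; **`JcComp hLc N cΛ₁ cB₁ R P : ∀ m, JetData 3 (Lc^m)`**,
  PIECEWISE: `JcComp 0 := JcOf hLc N (fun _ => cΛ₁) (fun _ => cB₁) 0` (unread), **`JcComp 1 := JcOf hLc N (fun _ => cΛ₁) (fun _ => cB₁) 1` BY FIAT** (ROOT M‴'s level-0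
  member at the depth-1 locks `cΛ₁ cB₁` — #28 §5's `hJc1` by `rfl`; `hbase` is an2 g42's `TshotOf_JcOf_one`, untouched), **`JcComp (m+2) := pullJ … (R.hs (m+2)) (JNat R P (m+2))`**
  (F6e ✓: `Ψ̂_{m+2}`-dressing then block-mean dressing of the raw composite jets); `JcComp_zero ∕ _one ∕ _succ_succ` (`rfl`).
* §3 [folklore] THE ROAD's NAMINGS (R-FP-68 (a); SPEC §1): `AN R j := compChart R.rc Lc (j+1) (R.s (j+1)) (Lc^(j+1))` (the composite one-shot chart at depth `j+1`),
  `VN R P j := vertexOfK (AN R j) (Lc^(j+1)) (JNat R P (j+1)).S`, `WN R P j := (JNat R P (j+1)).W`; and **(L2′) BY NAME**: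
  **`TshotOf_JcComp_succ_succ : TshotOf Lc (JcComp …) (m+2) = hessKer (AN R (m+1)) (VN R P (m+1)) (WN R P (m+1))`** (F6e's `TOf_pullJ` read backwards — no inverse
  problem, no `Υ_m`, no (TAB)), **`hN_JcComp : ∀ j ≥ 1, ∀ a b z, hessKer (AN R j) (VN R P j) (WN R P j) a b z = TshotOf Lc (JcComp …) (j+1) a b z`** (#28's `hN` LETTER, its
  literal shape), `TshotOf_JcComp_one` (= `TbalOf Lc Js 0` at ROOT M‴'s `Js`, by `TshotOf_JcOf_one`).
* §4 [folklore] THE JUNCTION WITH #28 §5 (`FP/StepRecursionFeed.d1Tel_anchored_of_kernel_laws_wStep`, road «FP», R-FP-57): **`d1Tel_JcComp_of_kernel_laws_wStep`** —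
  `D1Tel Lc Js (JcComp hLc N cΛ cB R P)` at ROOT M‴'s `Js := JsB12CombShSym hLc N (symTablesAn1S2 3 Lc cΛ) cΛ cB` FROM the road's displayed rows ONLY: the kernel law
  `hlaw` for `𝒦N j := hessKer (AN R j) (VN R P j) (WN R P j)`, the identifications `hF ∕ hG`, and the step kernels' (T0)(T1) — `hJc1 := rfl`, `hN := hN_JcComp`.  THE PAIR
  `(Js, Jc)` IS NAMED ONCE HERE (the OWNER d1-p3's acceptance criterion for F6d, R-FP-66 ∕ A-RFP66-1): `Js` = M‴'s literal UNCHANGED, `Jc := JcComp`.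
LOCATED (the ONE identity the (β1) re-basing still owes at the bottom, NOT in this file): #42b's `_anchored` twins (`FP/StepRecursionFeedNested.d1Tel_anchored_of_hessKer_laws_anchored_wStep`)
take `hN` FROM STOREY `0` ON; `hN 0 : hessKer (AN R 0) (VN R P 0) (WN R P 0) = TshotOf Lc JcComp 1 = TOf (JcOf … 1)` is NOT by construction here (depth 1 is the literal BY FIAT) —
it is the DEPTH-1 IDENTITY (H-1) chart: `compChart rc Lc 1 (s 1) Lc` AT THE SYM CORRECTOR `= GcombSh Lc 0` (F2-class, after K-U3d's `psiKSym`), (H-2) tables: `tabsComp r Lc 1 (cM 1)`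
`≅ symTablesAn1S2 3 Lc cΛ₁` along `Lc¹ = Lc` at `r = ctrOff`, `cM 1 = cΛ₁·wM1` (F6d-1b's four anchors `compV_one ∕ compH_one ∕ compB_ctrOff_one ∕ compMix_one` + F6b's `symTablesAn1S2_eq_tabsOf`,
transported as `CombOneShotJets.TOf_JsB12CombShSym_congr`), (H-3) pins: `P` at depth 1 = the literal's.  With the NON-anchored #28 §5 used in §4, (H-1)–(H-3) sit inside the
displayed `hF` at `j = 1` (`hF₁`) — the road's ∕ the row's sym-instance item, said here so that no reader takes §4 for more than it is.
WHAT THIS IS NOT: not the kernel law `hlaw` (the TORUS door #21∕#41d de-periodised by #41c∕#42c — road «FP»'s, over the (β1) suppliers' sym rows: leaf-06 G-files,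
leaf-02 R-18+, leaf-05 `TorusEffFormCompositeG`, K-U3d's sym corrector), not `hF ∕ hG` (the road's #42a ∕ (F2) chart identity), not (T0)(T1) (an1∕an3's Ward letters at
the literal), not the sym-corrector instance (`psiK` here — the running instance; `psiKSym` re-instantiates F6e §3 ∕ F6d-1b §2 ∕ this file the day K-U3d lands it),
not the units pin P-F6-2 (parameters `P : Pins`), not the (T·)-class translation letters of `(JcComp m).S ∕ .W` (road BF-x's `m ≥ 2` pins under (D-b), Q-an2-g51-4 —
on ask; the (L·) letters ARE the record's fields `.loc ∕ .loc₂`); nothing of Bałaban's asserted, valued or discharged; 0 estimates; 0∕4 row-D1 binders (hW, hR THEOREMS at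
the locks; `D1Tel` here is a CONDITIONAL assembly over displayed rows, exactly as #28's); RECORD = ROOT M‴ p325680 UNCHANGED, NO RE-POINTING; NOT (C1) complete,
NOT (L2′) discharged beyond the naming, NOT (T-ID), NOT D1, NEVER «G-an2-4 closed», NOT BetaPertH, NOT continuum, NOT Clay.  [folklore] packaging BY NAME +
[our object — bookkeeping] two parameter structures (`Roots`, `Pins`) and six definitions (`Roots.ctr`, `JNat`, `JcComp`, `AN`, `VN`, `WN`); no `def … : Prop`,
nothing cited, 0 sorry.

HONEST DEPENDENCY (page 1, mandatory): continuum YM on T⁴ ⇐ BetaPertH ∧ nine spine estimates (0/9 proved); BetaPertH ⇐ (D1) ∧ (D4) ∧ CAP+tail;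
G-an2-4 gates asym, D1 and NE2/3/4.  HONEST FRAMING (cell contract, verbatim): «discharging `BetaPertH` makes Bałaban's UV stability UNCONDITIONAL —
a real constructive-QFT result; it is NOT the continuum limit and NOT the Clay problem.»  ABSOLUTE RULE (cell charter, verbatim): «No internally-minted
statement may enter as a cited fact. Every hypothesis is either kernel-proved in this package or a verbatim quotation of a PUBLISHED theorem with page
reference. The manuscript(s) under audit are NOT citable for their own disputed steps — they are the thing under adjudication; programme-internal
(2001/route/tribunal) claims are never citable.»  Row D1 ∕ (C1) OWNER an2 (b2b-balaban-beta-an2), gens 53–54, 2026-08-24.  No existing file touched.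
-/

noncomputable section

namespace Summit.QuantumFields.BalabanUV.Beta.CompositeOneShotJetData

open Literature.MathematicalPhysics.QuantumFieldTheory
open Literature.MathematicalPhysics.QuantumFieldTheory.Balaban1983to89
open Literature.MathematicalPhysics.QuantumFieldTheory.Balaban1983to89.Beta
open DressedMomentNormalisation (EKer dressedEntry)
open ExpKernelCalculus (MKer hessKer)
open AffineAveraging (Site box toSite)
open AveragingContoursRooted (ctr ctrOff ctrOff_mem_box)
open OneStepResolventKernel (Fib KInv JetData TOf)
open OneStepKernelFamily (TshotOf TbalOf D1Tel vertexOfK)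
open HessianTelescopingKKT (wStep)
open Summit.QuantumFields.BalabanUV.Beta.AxialDressingRooted (one_le_of_neZero)
open Summit.QuantumFields.BalabanUV.Beta.SymSecondOrderTablesAn1 (symTablesAn1S2)
open Summit.QuantumFields.BalabanUV.Beta.CombChartJointEnd (JsB12CombShSym)
open Summit.QuantumFields.BalabanUV.Beta.CombOneShotJets (JcOf JcOf_apply TshotOf_JcOf_one)
open Summit.QuantumFields.BalabanUV.Beta.FP.StepRecursionFeed (d1Tel_anchored_of_kernel_laws_wStep)
open Summit.QuantumFields.BalabanUV.Beta.CompositeCorrectorDress (compChart pullJ TOf_pullJ)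
open Summit.QuantumFields.BalabanUV.Beta.ChartStepJets (SchartOf WchartOf)
open Summit.QuantumFields.BalabanUV.Beta.CompositeOneShotJets (tabsComp JN JN_S JN_W)

/-! ## §1 The parameter records: roots and pins -/

/-- [our object — bookkeeping] **THE ROOTS OF THE COMPOSITE CONSTRUCTION at blocking `Lc`** (`d + 1 = 4`): the corrector's root list `rc` (K-U3d's `psiK rc Lc m`), the brick root `r`
(the (0.4)-symmetrised one-step bricks are read at `toSite r`), and the in-block big-root offset `s m ∈ box 4 (Lc^m)` of the block-mean dressing at depth `m`, with memberships. -/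
structure Roots (Lc : ℕ) where
  /-- the corrector's root list -/
  rc : ℕ → Fin (3 + 1) → ℕ
  /-- its memberships -/
  hrc : ∀ k : ℕ, rc k ∈ box (3 + 1) Lc
  /-- the brick root -/
  r : Fin (3 + 1) → ℕ
  /-- its membership -/
  hr : r ∈ box (3 + 1) Lc
  /-- the big-root offset at depth `m` (blocking `Lc^m`) -/
  s : ℕ → Fin (3 + 1) → ℕ
  /-- its membership -/
  hs : ∀ m : ℕ, s m ∈ box (3 + 1) (Lc ^ m)

/-- [our object — bookkeeping] **THE (β1) TOWER's ROOTS: CENTRED AT EVERY LEVEL** (R-D1-g49-1 ∕ R-D1-g52-1; leaf-05's F6f `TowerRootCentred`: the composed big root of centred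
one-step roots is `ctr 4 (Lc^m)`): `rc k = r = ctrOff 4 Lc`, `s m = ctrOff 4 (Lc^m)`. -/
def Roots.ctr (Lc : ℕ) [NeZero Lc] : Roots Lc where
  rc := fun _ => ctrOff (3 + 1) Lc
  hrc := fun _ => show ctrOff (3 + 1) Lc ∈ box (3 + 1) Lc from ctrOff_mem_box (one_le_of_neZero Lc)
  r := ctrOff (3 + 1) Lc
  hr := ctrOff_mem_box (one_le_of_neZero Lc)
  s := fun m => ctrOff (3 + 1) (Lc ^ m)
  hs := fun m => show ctrOff (3 + 1) (Lc ^ m) ∈ box (3 + 1) (Lc ^ m) from ctrOff_mem_box (one_le_of_neZero (Lc ^ m))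

/-- [folklore] the centred roots, by definition. -/
theorem Roots.ctr_rc (Lc : ℕ) [NeZero Lc] (k : ℕ) : (Roots.ctr Lc).rc k = ctrOff (3 + 1) Lc := rfl

/-- [folklore] (`rfl`). -/
theorem Roots.ctr_r (Lc : ℕ) [NeZero Lc] : (Roots.ctr Lc).r = ctrOff (3 + 1) Lc := rfl

/-- [folklore] (`rfl`). -/
theorem Roots.ctr_s (Lc : ℕ) [NeZero Lc] (m : ℕ) : (Roots.ctr Lc).s m = ctrOff (3 + 1) (Lc ^ m) := rfl

/-- [folklore] the centred big root IS `ctr 4 (Lc^m)` (`ctr = toSite ∘ ctrOff`, `rfl`). -/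
theorem Roots.toSite_ctr_s (Lc : ℕ) [NeZero Lc] (m : ℕ) :
    toSite ((Roots.ctr Lc).s m) = AveragingContoursRooted.ctr (3 + 1) (Lc ^ m) := rfl

/-- [our object — bookkeeping] **THE DEPTH-INDEXED PINS of the (III′)-shaped literal at blocking `Lc^m`** (PIN P-F6-2 — parameters): multiplier scalars `cM m : ℕ → ℝ`, first-order pins
`cE cVH cΛ`, second-order pins `cE₂ cB`, the Wilson second-order table `T m`. -/
structure Pins where
  /-- multiplier scalar family at depth `m` -/
  cM : ℕ → ℕ → ℝ
  /-- Wilson first-order pin -/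
  cE : ℕ → ℝ
  /-- border first-order pin -/
  cVH : ℕ → ℝ
  /-- multiplier ∕ Λ pin -/
  cΛ : ℕ → ℝ
  /-- Wilson second-order pin -/
  cE₂ : ℕ → ℝ
  /-- row-border second-order pin -/
  cB : ℕ → ℝ
  /-- Wilson second-order table -/
  T : ℕ → Fin 4 → Fin 4 → Fin 4 → Fin 4 → ℝ

/-! ## §2 The composite one-shot jet data of record, piecewise -/

section Data

variable {Lc : ℕ} [NeZero Lc]

/-- [our object — bookkeeping] **THE RAW COMPOSITE ONE-SHOT JETS AT DEPTH `m`** over the roots `R` and pins `P`: F6d-1b's `JN` at blocking `Lc^m` (the (III′)-shaped literal's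
level-0 member at the constant chart family `compChart R.rc Lc m (R.s m) (Lc^m)` over `tabsComp R.r Lc m (P.cM m)`). -/
def JNat (R : Roots Lc) (P : Pins) (m : ℕ) : JetData 3 (Lc ^ m) :=
  JN (one_le_of_neZero Lc) R.hrc m (R.hs m) R.hr (P.cM m) (P.cE m) (P.cVH m) (P.cΛ m) (P.cE₂ m) (P.cB m) (P.T m)

/-- [folklore] `JNat` unfolded (`rfl`). -/
theorem JNat_eq (R : Roots Lc) (P : Pins) (m : ℕ) :
    JNat R P m = JN (one_le_of_neZero Lc) R.hrc m (R.hs m) R.hr (P.cM m) (P.cE m) (P.cVH m) (P.cΛ m) (P.cE₂ m) (P.cB m) (P.T m) := rfl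

/-- [folklore] its first-order family: `SchartOf (fun _ => compChart …) (tabsComp …) (cE m) (cVH m) (cΛ m) 0` (F6d-1b `JN_S`). -/
theorem JNat_S (R : Roots Lc) (P : Pins) (m : ℕ) :
    (JNat R P m).S = SchartOf (fun _ => compChart R.rc Lc m (R.s m) (Lc ^ m)) (tabsComp m (one_le_of_neZero Lc) R.hr (P.cM m)) (P.cE m) (P.cVH m) (P.cΛ m) 0 :=
  rfl

/-- [folklore] its second-order family: `WchartOf (fun _ => compChart …) (tabsComp …) … 0` (F6d-1b `JN_W`). -/
theorem JNat_W (R : Roots Lc) (P : Pins) (m : ℕ) :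
    (JNat R P m).W = WchartOf (fun _ => compChart R.rc Lc m (R.s m) (Lc ^ m)) (tabsComp m (one_le_of_neZero Lc) R.hr (P.cM m))
      (P.cE m) (P.cVH m) (P.cΛ m) (P.cE₂ m) (P.cB m) (P.T m) 0 :=
  rfl

/-- [our object — bookkeeping] **THE COMPOSITE ONE-SHOT JET DATA OF RECORD, DIRECT AND PIECEWISE** (SPEC S-an2-g52-1 §1, design (D-b)): depth `0` unread and depth `1` = ROOT M‴'s
one-shot literal `JcOf` at the depth-1 locks `cΛ₁ cB₁` (BY FIAT — #28 §5's `hJc1` by `rfl`); depth `m + 2` = THE RAW COMPOSITE JETS PULLED BACK TO THE STRAIGHT CHART by F6e's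
`pullJ` (`Ψ̂_{m+2}`-dressing, then block-mean dressing at the big root `R.s (m+2)`). -/
def JcComp (hLc : Odd Lc) (N : ℕ) (cΛ₁ cB₁ : ℝ) (R : Roots Lc) (P : Pins) : ∀ m : ℕ, JetData 3 (Lc ^ m)
  | 0 => JcOf hLc N (fun _ => cΛ₁) (fun _ => cB₁) 0
  | 1 => JcOf hLc N (fun _ => cΛ₁) (fun _ => cB₁) 1
  | (m + 2) => pullJ (Nat.pos_of_ne_zero (NeZero.ne Lc)) R.hrc (m + 2) (R.hs (m + 2)) (JNat R P (m + 2))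

variable (hLc : Odd Lc) (N : ℕ) (cΛ₁ cB₁ : ℝ) (R : Roots Lc) (P : Pins)

/-- [folklore] depth `0` (`rfl`; unread by every consumer). -/
theorem JcComp_zero : JcComp hLc N cΛ₁ cB₁ R P 0 = JcOf hLc N (fun _ => cΛ₁) (fun _ => cB₁) 0 := rfl

/-- [folklore] **`hJc1` — DEPTH 1 IS ROOT M‴'s ONE-SHOT LITERAL AT THE LOCKS** (`rfl`): #28 §5 `d1Tel_anchored_of_kernel_laws_wStep`'s first binder. -/
theorem JcComp_one : JcComp hLc N cΛ₁ cB₁ R P 1 = JcOf hLc N (fun _ => cΛ₁) (fun _ => cB₁) 1 := rfl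

/-- [folklore] depth `m + 2` is the pulled-back raw composite datum (`rfl`). -/
theorem JcComp_succ_succ (m : ℕ) :
    JcComp hLc N cΛ₁ cB₁ R P (m + 2) = pullJ (Nat.pos_of_ne_zero (NeZero.ne Lc)) R.hrc (m + 2) (R.hs (m + 2)) (JNat R P (m + 2)) := rfl

end Data

/-! ## §3 The road's namings and (L2′) `hN` by name -/

section Namings

variable {Lc : ℕ} [NeZero Lc]

/-- [our object — bookkeeping] **THE N-SYSTEM's CHART at door index `j`** (depth `j + 1`): the composite one-shot chart `Ψ̂_{j+1} ∘ coDressKBmAt (toSite (s (j+1))) (Lc^(j+1)) KInv ∘ Ψ̂ᵀ_{j+1}`. -/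
def AN (R : Roots Lc) (j : ℕ) : MKer (3 + 1) (Fib 3) :=
  compChart R.rc Lc (j + 1) (R.s (j + 1)) (Lc ^ (j + 1))

/-- [our object — bookkeeping] **THE N-SYSTEM's FIRST-ORDER VERTEX FAMILY at door index `j`**: `vertexOfK (AN R j) (Lc^(j+1)) (JNat R P (j+1)).S`. -/
def VN (R : Roots Lc) (P : Pins) (j : ℕ) : Fin (3 + 1) → Site (3 + 1) → MKer (3 + 1) (Fib 3) :=
  vertexOfK (AN R j) (Lc ^ (j + 1)) (JNat R P (j + 1)).S

/-- [our object — bookkeeping] **THE N-SYSTEM's SECOND-ORDER VERTEX FAMILY at door index `j`**: `(JNat R P (j+1)).W`. -/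
def WN (R : Roots Lc) (P : Pins) (j : ℕ) : Fin (3 + 1) → Site (3 + 1) → Fin (3 + 1) → Site (3 + 1) → MKer (3 + 1) (Fib 3) :=
  (JNat R P (j + 1)).W

/-- [folklore] `AN` unfolded (`rfl`). -/
theorem AN_eq (R : Roots Lc) (j : ℕ) : AN R j = compChart R.rc Lc (j + 1) (R.s (j + 1)) (Lc ^ (j + 1)) := rfl

/-- [folklore] `VN` unfolded (`rfl`). -/
theorem VN_eq (R : Roots Lc) (P : Pins) (j : ℕ) : VN R P j = vertexOfK (AN R j) (Lc ^ (j + 1)) (JNat R P (j + 1)).S := rfl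

/-- [folklore] `WN` unfolded (`rfl`). -/
theorem WN_eq (R : Roots Lc) (P : Pins) (j : ℕ) : WN R P j = (JNat R P (j + 1)).W := rfl

variable (hLc : Odd Lc) (N : ℕ) (cΛ₁ cB₁ : ℝ) (R : Roots Lc) (P : Pins)

/-- [folklore] **(L2′) AT DEPTH `m + 2` — THE ONE-SHOT KERNEL OF `JcComp` IS THE COMPOSITE SYSTEM's ONE-LOOP KERNEL IN ITS OWN CHART**:
`TshotOf Lc JcComp (m+1+1) = hessKer (AN R (m+1)) (VN R P (m+1)) (WN R P (m+1))` — F6e's `TOf_pullJ` read backwards. -/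
theorem TshotOf_JcComp_succ_succ (m : ℕ) :
    TshotOf Lc (JcComp hLc N cΛ₁ cB₁ R P) (m + 1 + 1) = hessKer (AN R (m + 1)) (VN R P (m + 1)) (WN R P (m + 1)) := by
  show TOf (N := Lc ^ (m + 1 + 1)) (JcComp hLc N cΛ₁ cB₁ R P (m + 1 + 1)) = _
  rw [JcComp_succ_succ]
  exact TOf_pullJ (Nat.pos_of_ne_zero (NeZero.ne Lc)) R.hrc (m + 1 + 1) (R.hs (m + 1 + 1)) (JNat R P (m + 1 + 1))

/-- [folklore] **`hN` — #28's IDENTIFICATION LETTER IN ITS LITERAL SHAPE**: for every `j ≥ 1`,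
`hessKer (AN R j) (VN R P j) (WN R P j) a b z = TshotOf Lc JcComp (j+1) a b z`. -/
theorem hN_JcComp : ∀ j : ℕ, 1 ≤ j → ∀ (a b : Fin 4) (z : Fin 4 → ℤ),
    hessKer (AN R j) (VN R P j) (WN R P j) a b z = TshotOf Lc (JcComp hLc N cΛ₁ cB₁ R P) (j + 1) a b z := by
  intro j hj a b z
  obtain ⟨m, rfl⟩ : ∃ m : ℕ, j = m + 1 := ⟨j - 1, (Nat.sub_add_cancel hj).symm⟩
  exact (congrFun (congrFun (congrFun (TshotOf_JcComp_succ_succ hLc N cΛ₁ cB₁ R P m) a) b) z).symm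

/-- [folklore] **`hbase` AT THE NAMED DATA — DEPTH 1 IS ROOT M‴'s ONE-STEP KERNEL AT LEVEL 0**: `TshotOf Lc JcComp 1 = TbalOf Lc (JsB12CombShSym hLc N (symTablesAn1S2 3 Lc cΛ₁) cΛ₁ cB₁) 0`
(an2 g42's `TshotOf_JcOf_one` through `JcComp_one`). -/
theorem TshotOf_JcComp_one :
    TshotOf Lc (JcComp hLc N cΛ₁ cB₁ R P) 1 = TbalOf Lc (JsB12CombShSym hLc N (symTablesAn1S2 3 Lc cΛ₁) cΛ₁ cB₁) 0 := by
  have h1 : TshotOf Lc (JcComp hLc N cΛ₁ cB₁ R P) 1 = TshotOf Lc (JcOf hLc N (fun _ => cΛ₁) (fun _ => cB₁)) 1 := by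
    show TOf (N := Lc ^ 1) (JcComp hLc N cΛ₁ cB₁ R P 1) = TOf (N := Lc ^ 1) (JcOf hLc N (fun _ => cΛ₁) (fun _ => cB₁) 1)
    rw [JcComp_one]
  exact h1.trans (TshotOf_JcOf_one hLc N (fun _ => cΛ₁) (fun _ => cB₁))

end Namings

/-! ## §4 The junction with #28 §5: `D1Tel` at the named pair from the road's displayed rows -/

section Junction

variable {Lc : ℕ} [NeZero Lc]

/-- [folklore] **`D1Tel` AT THE NAMED PAIR `(Js, Jc) = (M‴'s literal, JcComp)` FROM THE ROAD's DISPLAYED ROWS** — #28 §5 `d1Tel_anchored_of_kernel_laws_wStep` with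
`Jc := JcComp hLc N cΛ cB R P`, `𝒦N j := hessKer (AN R j) (VN R P j) (WN R P j)`, `hJc1 := rfl`, `hN := hN_JcComp`; DISPLAYED (the road's and the Ward suppliers'):
the kernel law `hlaw`, the identifications `hF` (dressed one-shot kernel one depth down, canonical weight `wStep`) and `hG` (the one-step kernel of the literal), and
the step kernels' (T0)(T1).  A CONDITIONAL assembly; nothing discharged here. -/
theorem d1Tel_JcComp_of_kernel_laws_wStep (hLc : Odd Lc) (N : ℕ) (cΛ cB : ℝ) (R : Roots Lc) (P : Pins) (𝒦F 𝒦G : ℕ → EKer 4)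
    (hlaw : ∀ j : ℕ, 1 ≤ j → ∀ (a b : Fin 4) (z : Fin 4 → ℤ), hessKer (AN R j) (VN R P j) (WN R P j) a b z = 𝒦F j a b z + 𝒦G j a b z)
    (hF : ∀ j : ℕ, 1 ≤ j → ∀ (a b : Fin 4) (z : Fin 4 → ℤ),
      𝒦F j a b z = (Lc : ℝ) ^ 8 * dressedEntry (wStep Lc j) (TshotOf Lc (JcComp hLc N cΛ cB R P) j) ((Lc : ℤ) • z) a b)
    (hG : ∀ j : ℕ, 1 ≤ j → ∀ (a b : Fin 4) (z : Fin 4 → ℤ),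
      𝒦G j a b z = TbalOf Lc (JsB12CombShSym hLc N (symTablesAn1S2 3 Lc cΛ) cΛ cB) j a b z)
    (hT0 : ∀ j (c e : Fin 4), HasSum (TbalOf Lc (JsB12CombShSym hLc N (symTablesAn1S2 3 Lc cΛ) cΛ cB) j c e) 0)
    (hT1 : ∀ j (c e ρ : Fin 4), HasSum (fun t : Fin 4 → ℤ => t ρ • TbalOf Lc (JsB12CombShSym hLc N (symTablesAn1S2 3 Lc cΛ) cΛ cB) j c e t) 0) :
    D1Tel Lc (JsB12CombShSym hLc N (symTablesAn1S2 3 Lc cΛ) cΛ cB) (JcComp hLc N cΛ cB R P) :=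
  d1Tel_anchored_of_kernel_laws_wStep hLc N cΛ cB (JcComp hLc N cΛ cB R P) (JcComp_one hLc N cΛ cB R P)
    (fun j => hessKer (AN R j) (VN R P j) (WN R P j)) 𝒦F 𝒦G hlaw (hN_JcComp hLc N cΛ cB R P) hF hG hT0 hT1

/-- [folklore] **THE (β1) TOWER's INSTANCE**: the same at the CENTRED roots `Roots.ctr Lc`. -/
theorem d1Tel_JcComp_ctr_of_kernel_laws_wStep (hLc : Odd Lc) (N : ℕ) (cΛ cB : ℝ) (P : Pins) (𝒦F 𝒦G : ℕ → EKer 4)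
    (hlaw : ∀ j : ℕ, 1 ≤ j → ∀ (a b : Fin 4) (z : Fin 4 → ℤ),
      hessKer (AN (Roots.ctr Lc) j) (VN (Roots.ctr Lc) P j) (WN (Roots.ctr Lc) P j) a b z = 𝒦F j a b z + 𝒦G j a b z)
    (hF : ∀ j : ℕ, 1 ≤ j → ∀ (a b : Fin 4) (z : Fin 4 → ℤ),
      𝒦F j a b z = (Lc : ℝ) ^ 8 * dressedEntry (wStep Lc j) (TshotOf Lc (JcComp hLc N cΛ cB (Roots.ctr Lc) P) j) ((Lc : ℤ) • z) a b)
    (hG : ∀ j : ℕ, 1 ≤ j → ∀ (a b : Fin 4) (z : Fin 4 → ℤ),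
      𝒦G j a b z = TbalOf Lc (JsB12CombShSym hLc N (symTablesAn1S2 3 Lc cΛ) cΛ cB) j a b z)
    (hT0 : ∀ j (c e : Fin 4), HasSum (TbalOf Lc (JsB12CombShSym hLc N (symTablesAn1S2 3 Lc cΛ) cΛ cB) j c e) 0)
    (hT1 : ∀ j (c e ρ : Fin 4), HasSum (fun t : Fin 4 → ℤ => t ρ • TbalOf Lc (JsB12CombShSym hLc N (symTablesAn1S2 3 Lc cΛ) cΛ cB) j c e t) 0) :
    D1Tel Lc (JsB12CombShSym hLc N (symTablesAn1S2 3 Lc cΛ) cΛ cB) (JcComp hLc N cΛ cB (Roots.ctr Lc) P) :=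
  d1Tel_JcComp_of_kernel_laws_wStep hLc N cΛ cB (Roots.ctr Lc) P 𝒦F 𝒦G hlaw hF hG hT0 hT1

end Junction

end Summit.QuantumFields.BalabanUV.Beta.CompositeOneShotJetData

end
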